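import Mathlib
import Summits.Ventures.PercRepro2.TB14DomZ

/-!
# Row 2′TB: the LOCAL HALL family — every change at `a₂`'s red cluster minus `a₂`
(blind cell PercRepro2, mine-c g24, 2026-08-26; `conjectures/MINE-C.md` §33.6)

A LOCAL MOVE of a source `y` is any recolouring `y'` whose changed edges all touch the red cluster
of `a₂` with `a₂` itself removed (`IsLocalMove`).  It is the weakest move family of the injection
programme: every release move (`TB14DomZ.IsReleaseMove`, relation R23, the family of record) is a
local move (`isLocalMove_of_isReleaseMove`), so Hall for the release moves gives Hall for the local moves
(`LocalHall_of_DomZRelease`), and Hall for the local moves still gives the row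
(`tb14_of_localHallAt`, `TB14_of_LocalHall`).  Census (MINE-C.md §33.6, own code): 0 Hall
failures on all 5-vertex instances and all 6-vertex graphs with ≤ 8 edges for this family, and,
through the release moves, on kit j249277's bars (n = 7 all graphs with ≤ 9 edges, random
8-vertex graphs).  Of its sub-families, the SIGNED-MONOTONE one (inside the cluster only red →
blue, on its outer boundary only blue → red) keeps 0 failures on the same bars, the STAR FLIPS
(the whole star of the released set complemented) fail from 7 vertices (NEG-174), the fully
monotone one fails from 5.  Own work; standard axioms.
-/

namespace Summit.Ventures.PercRepro2

namespace TB14LocalHall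

open CovForm A3InactiveTyped TB14Fold TB14FlipFamily TB14Hall TB14DomZ

section Move

variable {V : Type} {E : Type}
variable (ends : E → Sym2 V) (a₂ : V)

/-- A LOCAL MOVE: every changed edge has an end in the red cluster of `a₂` other than `a₂`. -/
def IsLocalMove (y y' : Config E) : Prop :=
  ∀ e, y' e ≠ y e → ∃ v ∈ ends e, v ≠ a₂ ∧ Conn ends y a₂ v

/-- A release move is a local move: the released part lies in the red cluster of `a₂` and
misses `a₂`. -/
theorem isLocalMove_of_isReleaseMove {o : V} {y y' : Config E}
    (h : IsReleaseMove ends a₂ o y y') : IsLocalMove ends a₂ y y' := by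
  intro e he
  by_contra hcon
  apply he
  apply h.off e
  intro x hx hrel
  refine hcon ⟨x, hx, ?_, hrel.1⟩
  rintro rfl
  exact hrel.2 (conn_refl _ _ _)

end Move

section Hall

variable {V : Type} {E : Type} [Fintype E] [DecidableEq E]
variable (ends : E → Sym2 V) (a₁ a₂ b o : V) (F : Finset E)

open Classical in
/-- The local moves of `y` that are targets of row 2′TB. -/
noncomputable def localMoves (y : Config E) : Finset (Config E) :=
  Finset.univ.filter fun y' => IsTgt ends a₁ a₂ b o F y' ∧ IsLocalMove ends a₂ y y'

open Classical in
/-- **Hall's condition for the local moves** at the profile `(F, z)` of one instance. -/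
def LocalHallAt (z : Config E) : Prop :=
  ∀ S ⊆ srcSet ends a₁ a₂ b o F z, S.card ≤ (S.biUnion (localMoves ends a₁ a₂ b o F)).card

open Classical in
/-- Every release move that is a target is a local move that is a target. -/
theorem releaseMoves_subset_localMoves (y : Config E) :
    releaseMoves ends a₁ a₂ b o F y ⊆ localMoves ends a₁ a₂ b o F y := by
  intro w hw
  rw [releaseMoves, Finset.mem_filter] at hw
  exact Finset.mem_filter.2 ⟨hw.1, hw.2.1, isLocalMove_of_isReleaseMove ends a₂ hw.2.2⟩

open Classical in
/-- Hall for the release moves gives Hall for the local moves (more moves, the same sources). -/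
theorem localHallAt_of_releaseHallAt (z : Config E) (h : ReleaseHallAt ends a₁ a₂ b o F z) :
    LocalHallAt ends a₁ a₂ b o F z := by
  intro S hS
  refine (h S hS).trans (Finset.card_le_card ?_)
  intro x hx
  rw [Finset.mem_biUnion] at hx ⊢
  obtain ⟨y, hy, hxy⟩ := hx
  exact ⟨y, hy, releaseMoves_subset_localMoves ends a₁ a₂ b o F y hxy⟩

open Classical in
/-- **Local Hall at the all-free profile gives the row there** (through `tb14_of_hall`). -/
theorem tb14_of_localHallAt {R : Type*} [Field R] [LinearOrder R] [IsStrictOrderedRing R]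
    (z : Config E) (hF : ∀ e, e ∈ F) (h : LocalHallAt ends a₁ a₂ b o F z) :
    pairCount F z (sameBO ends a₁ a₂ b o : Config E → Config E → R) ≤
      pairCount F z (crossBO ends a₁ a₂ b o) := by
  refine tb14_of_hall ends a₁ a₂ b o F z (localMoves ends a₁ a₂ b o F) ?_ h
  intro y _ w hw
  exact Finset.mem_filter.2
    ⟨Finset.mem_univ _, adm_of_allFree F z hF _, (Finset.mem_filter.1 hw).2.1⟩

end Hall

/-- **(LOCAL HALL)** (a Prop, NOT a theorem — the weakest Hall statement of the injection
programme, MINE-C.md §33.6): on every finite multigraph, for every roots `a₁ a₂` and marks `b o`,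
Hall's condition holds for the local moves of the sources of row 2′TB at the all-free profile. -/
def LocalHall : Prop :=
  ∀ (V E : Type) [Fintype E] [DecidableEq E] (ends : E → Sym2 V) (a₁ a₂ b o : V),
    LocalHallAt ends a₁ a₂ b o Finset.univ (fun _ => false)

/-- The release form of (DOM-Z) implies (LOCAL HALL). -/
theorem LocalHall_of_DomZRelease (h : DomZRelease) : LocalHall :=
  fun V E _ _ ends a₁ a₂ b o =>
    localHallAt_of_releaseHallAt ends a₁ a₂ b o Finset.univ (fun _ => false)
      (h V E ends a₁ a₂ b o)

/-- **Row 2′TB follows from (LOCAL HALL)** at every profile. -/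
theorem TB14_of_LocalHall (R : Type*) [Field R] [LinearOrder R] [IsStrictOrderedRing R]
    (h : LocalHall) : TB14 R :=
  TB14Cut.TB14_of_allFree R fun V E _ _ ends a₁ a₂ b o =>
    tb14_of_localHallAt ends a₁ a₂ b o Finset.univ (fun _ => false)
      (fun e => Finset.mem_univ e) (h V E ends a₁ a₂ b o)

end TB14LocalHall

end Summit.Ventures.PercRepro2
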